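import Literature.NumberTheory.LFunctions.TypeLimitsExist

/-!
# Convergence of the gcd-class sums ([CV] Lemma 3.5, general form) and the multi-weight `M → ∞` step

Companion of `TypeLimitsExist.lean` (2001 magnification programme, archive `2001`: `rh-w-composite-vanishing/free/y1`
= [CV] Lemmas 3.3–3.5, `rh-w-magnification/free/y1` = W-MAG §§3–5).  The finite weighted type inequality produced by
an analytic machine (in the tree: the comb evaluation of the crux line
`Summits/RiemannHypothesis/RiemannHypothesis/Cruxes/ConeMagnification`, `COMB-EVALUATION.md` (TI_M)) carries cut-off
weights that depend on the gcd CLASS of `n` (through `log(ℓℓ'/gcd(nℓ',ℓ)²)`), not one weight `w_M(n)`.  Passing to the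
limit `M → ∞` then needs, for every class separately, (a) the convergence of the class sums
`∑_{n ≤ x, gcd(nℓ',ℓ) = δ} (c−Λ)(n)/n` and (b) the regularity of the weights on a convergent series.  This file PROVES:

* `gcd_mul_eq_of_forall_prime_le` — `gcd(nℓ', ℓ) = gcd(ℓ', ℓ)` when no prime `p ≤ L` divides `n` (`ℓ ∈ [1, L]`): every
  gcd class is, up to the multiples of the primes `≤ L`, either everything or nothing;
* `gcdForm_eq_sum_gcdClasses`, `re_gcdForm_eq_sum_gcdClasses` — the type weight `Re Φ_α(n)` is a finite real
  combination of gcd-class indicators `1[gcd(nℓ',ℓ) = δ]` (`δ ∣ ℓ`);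
* `summable_z_mul_sub_of_eq_off_smallPrimes`, `tendsto_sum_z_mul_of_eq_off_smallPrimes` (real-`x` partial sums) and
  `tendsto_sum_range_z_mul_of_eq_off_smallPrimes` (`ℕ`-indexed) — **[CV] Lemma 3.5, general form**: for `c ≥ 0` with local
  summability and `∑_{n ≤ x} (c−Λ)(n)/n → C₁`, and ANY bounded `f : ℕ → ℝ` with `f(n) = f(1)` whenever no prime `p ≤ L`
  divides `n` (class indicators, gcd forms, products of both), `∑_{n ≤ x} ((c−Λ)(n)/n) f(n) → f(1)·C₁ + ∑' ((c−Λ)(n)/n)(f(n) − f(1))`;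
* `sum_mul_re_gcdForm_eq_sum_gcdClasses`, `designData_of_mertens_local_classTypeIneq` — the design data AX-A ∧ AX-B ∧
  AX-C(`D`) from Mertens, local summability and the CLASS-WEIGHTED finite type inequalities, i.e. in the exact shape of
  the comb evaluation (TI_M): every gcd class may carry its own regular cut-off family;
* `typeLimit_le_of_eventually_le_sum` — the `M → ∞` step for finitely many pieces with their own regular weight families:
  if `∑_{n<N} a_j(n) → T_j` for `j ∈ s` and eventually `∑_{j∈s} ∑_{n<N_j i} a_j(n) w_{j,i}(n) ≤ D' + ε` (every `ε > 0`), then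
  `∑_{j∈s} T_j ≤ D'`.

Everything is PROVED (`[folklore]` tags); no analytic input.
-/

noncomputable section

open scoped BigOperators ComplexConjugate Classical
open Filter Finset ArithmeticFunction
open _root_.Topology

namespace Literature.NumberTheory.LFunctions

namespace TypeDesign

open GcdForm

/-! ### gcd classes are trivial off the multiples of the primes `≤ L` -/

/-- `gcd(nℓ', ℓ) = gcd(ℓ', ℓ)` for `ℓ ∈ [1, L]` when no prime `p ≤ L` divides `n`. [folklore] -/
theorem gcd_mul_eq_of_forall_prime_le {L n : ℕ} (hn : ∀ p : ℕ, p.Prime → p ≤ L → ¬ p ∣ n) {ℓ : ℕ}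
    (hℓ : ℓ ∈ Finset.Icc 1 L) (ℓ' : ℕ) : Nat.gcd (n * ℓ') ℓ = Nat.gcd ℓ' ℓ :=
  (coprime_of_forall_prime_le hn hℓ).gcd_mul_left_cancel ℓ'

/-- The indicator of a gcd class `{n : gcd(nℓ', ℓ) = δ}` (`ℓ ∈ [1, L]`) takes at `n` its value at `1` when no prime
`p ≤ L` divides `n`. [folklore] -/
theorem gcdClass_indicator_eq_of_forall_prime_le {L n : ℕ} (hn : ∀ p : ℕ, p.Prime → p ≤ L → ¬ p ∣ n) {ℓ : ℕ}
    (hℓ : ℓ ∈ Finset.Icc 1 L) (ℓ' δ : ℕ) :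
    (if Nat.gcd (n * ℓ') ℓ = δ then (1 : ℝ) else 0) = (if Nat.gcd (1 * ℓ') ℓ = δ then (1 : ℝ) else 0) := by
  rw [gcd_mul_eq_of_forall_prime_le hn hℓ, one_mul]

/-- **The gcd form decomposed over gcd classes**:
`Φ_α(n) = ∑_{ℓ,ℓ' ≤ L} ∑_{δ ∣ ℓ} α_ℓ conj(α_ℓ') (δ/√(ℓℓ')) · 1[gcd(nℓ', ℓ) = δ]`. [folklore] -/
theorem gcdForm_eq_sum_gcdClasses (α : ℕ → ℂ) (L n : ℕ) :
    gcdForm α L n = ∑ ℓ ∈ Finset.Icc 1 L, ∑ ℓ' ∈ Finset.Icc 1 L, ∑ δ ∈ ℓ.divisors,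
      α ℓ * (starRingEnd ℂ) (α ℓ') * ((δ : ℝ) : ℂ) / (Real.sqrt ((ℓ : ℝ) * ℓ') : ℂ) *
        (if Nat.gcd (n * ℓ') ℓ = δ then (1 : ℂ) else 0) := by
  unfold gcdForm
  refine Finset.sum_congr rfl fun ℓ hℓ => Finset.sum_congr rfl fun ℓ' _ => ?_
  have hℓ0 : ℓ ≠ 0 := by have := (Finset.mem_Icc.mp hℓ).1; omega
  have hmem : Nat.gcd (n * ℓ') ℓ ∈ ℓ.divisors := Nat.mem_divisors.mpr ⟨Nat.gcd_dvd_right _ _, hℓ0⟩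
  simp_rw [mul_ite, mul_one, mul_zero]
  rw [Finset.sum_ite_eq, if_pos hmem]

/-- Real-part form of `gcdForm_eq_sum_gcdClasses`: the type weight `Re Φ_α(n)` is a finite real combination of
gcd-class indicators. [folklore] -/
theorem re_gcdForm_eq_sum_gcdClasses (α : ℕ → ℂ) (L n : ℕ) :
    (gcdForm α L n).re = ∑ ℓ ∈ Finset.Icc 1 L, ∑ ℓ' ∈ Finset.Icc 1 L, ∑ δ ∈ ℓ.divisors,
      (α ℓ * (starRingEnd ℂ) (α ℓ') * ((δ : ℝ) : ℂ) / (Real.sqrt ((ℓ : ℝ) * ℓ') : ℂ)).re *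
        (if Nat.gcd (n * ℓ') ℓ = δ then (1 : ℝ) else 0) := by
  rw [gcdForm_eq_sum_gcdClasses, Complex.re_sum]
  refine Finset.sum_congr rfl fun ℓ _ => ?_
  rw [Complex.re_sum]
  refine Finset.sum_congr rfl fun ℓ' _ => ?_
  rw [Complex.re_sum]
  refine Finset.sum_congr rfl fun δ _ => ?_
  split_ifs <;> simp

/-! ### [CV] Lemma 3.5, general form -/

/-- Absolute convergence of `∑ ((c−Λ)(n)/n)(f(n) − f(1))` for bounded `f` constant (`= f 1`) off the multiples of
the primes `≤ L`. [folklore] -/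
theorem summable_z_mul_sub_of_eq_off_smallPrimes {c : ℕ → ℝ} (hc : ∀ n, 0 ≤ c n)
    (hloc : ∀ p : ℕ, p.Prime → Summable (fun n : ℕ => if p ∣ n then c n / n else 0))
    {L : ℕ} (f : ℕ → ℝ) {Bf : ℝ} (hfB : ∀ n, |f n| ≤ Bf)
    (hf1 : ∀ n, (∀ p : ℕ, p.Prime → p ≤ L → ¬ p ∣ n) → f n = f 1) :
    Summable fun n : ℕ => z c n * (f n - f 1) := by
  refine (Summable.of_nonneg_of_le (fun n => abs_nonneg _) (fun n => ?_)
    ((summable_abs_z_smallPrimes hc hloc L).mul_right (2 * Bf))).of_abs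
  rw [abs_mul]
  by_cases hex : ∃ p : ℕ, p.Prime ∧ p ≤ L ∧ p ∣ n
  · rw [if_pos hex]
    refine mul_le_mul_of_nonneg_left ?_ (abs_nonneg _)
    calc |f n - f 1| ≤ |f n| + |f 1| := abs_sub _ _
      _ ≤ Bf + Bf := add_le_add (hfB n) (hfB 1)
      _ = 2 * Bf := by ring
  · have hn : ∀ p : ℕ, p.Prime → p ≤ L → ¬ p ∣ n := fun p hp hpL hpn => hex ⟨p, hp, hpL, hpn⟩
    rw [if_neg hex, hf1 n hn, sub_self, abs_zero, mul_zero, zero_mul]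

/-- **[CV] Lemma 3.5 (general form, real-`x` partial sums).**  For `c ≥ 0` with local summability and
`∑_{n ≤ x} (c−Λ)(n)/n → C₁`, and `f` bounded with `f(n) = f(1)` whenever no prime `p ≤ L` divides `n`:
`∑_{n ≤ x} ((c−Λ)(n)/n) f(n) → f(1)·C₁ + ∑' ((c−Λ)(n)/n)(f(n) − f(1))`. [folklore] -/
theorem tendsto_sum_z_mul_of_eq_off_smallPrimes {c : ℕ → ℝ} (hc : ∀ n, 0 ≤ c n)
    (hloc : ∀ p : ℕ, p.Prime → Summable (fun n : ℕ => if p ∣ n then c n / n else 0))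
    {C₁ : ℝ} (hC₁ : Tendsto (fun x : ℝ => ∑ n ∈ Finset.Icc 1 ⌊x⌋₊,
      (c n - ArithmeticFunction.vonMangoldt n) / n) atTop (𝓝 C₁))
    {L : ℕ} (f : ℕ → ℝ) {Bf : ℝ} (hfB : ∀ n, |f n| ≤ Bf)
    (hf1 : ∀ n, (∀ p : ℕ, p.Prime → p ≤ L → ¬ p ∣ n) → f n = f 1) :
    Tendsto (fun x : ℝ => ∑ n ∈ Finset.Icc 1 ⌊x⌋₊,
        (c n - ArithmeticFunction.vonMangoldt n) / n * f n) atTop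
      (𝓝 (f 1 * C₁ + ∑' n : ℕ, (c n - ArithmeticFunction.vonMangoldt n) / n * (f n - f 1))) := by
  have h2 := tendsto_sum_Icc_floor_of_summable (f := fun n => z c n * (f n - f 1)) (by simp [z])
    (summable_z_mul_sub_of_eq_off_smallPrimes hc hloc f hfB hf1)
  have h1 := hC₁.const_mul (f 1)
  refine (h1.add h2).congr fun x => ?_
  simp only [z]
  rw [Finset.mul_sum, ← Finset.sum_add_distrib]
  refine Finset.sum_congr rfl fun n _ => ?_
  ring

/-- **[CV] Lemma 3.5 (general form, `ℕ`-indexed partial sums).**  As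
`tendsto_sum_z_mul_of_eq_off_smallPrimes`, along `N ↦ ∑_{n<N}`. [folklore] -/
theorem tendsto_sum_range_z_mul_of_eq_off_smallPrimes {c : ℕ → ℝ} (hc : ∀ n, 0 ≤ c n)
    (hloc : ∀ p : ℕ, p.Prime → Summable (fun n : ℕ => if p ∣ n then c n / n else 0))
    {C₁ : ℝ} (hC₁ : Tendsto (fun M : ℕ => ∑ n ∈ Finset.range M,
      (c n - ArithmeticFunction.vonMangoldt n) / n) atTop (𝓝 C₁))
    {L : ℕ} (f : ℕ → ℝ) {Bf : ℝ} (hfB : ∀ n, |f n| ≤ Bf)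
    (hf1 : ∀ n, (∀ p : ℕ, p.Prime → p ≤ L → ¬ p ∣ n) → f n = f 1) :
    Tendsto (fun M : ℕ => ∑ n ∈ Finset.range M,
        (c n - ArithmeticFunction.vonMangoldt n) / n * f n) atTop
      (𝓝 (f 1 * C₁ + ∑' n : ℕ, (c n - ArithmeticFunction.vonMangoldt n) / n * (f n - f 1))) := by
  have h2 := (summable_z_mul_sub_of_eq_off_smallPrimes hc hloc f hfB hf1).hasSum.tendsto_sum_nat
  have h1 := hC₁.const_mul (f 1)
  refine (h1.add h2).congr fun M => ?_
  simp only [z]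
  rw [Finset.mul_sum, ← Finset.sum_add_distrib]
  refine Finset.sum_congr rfl fun n _ => ?_
  ring

/-- The gcd-class sums converge ([CV] Lemma 3.5 as printed): for `ℓ ∈ [1, L]`, any `ℓ'`, `δ`,
`∑_{n<N, gcd(nℓ',ℓ) = δ} (c−Λ)(n)/n` has a limit. [folklore] -/
theorem gcdClassSum_converges {c : ℕ → ℝ} (hc : ∀ n, 0 ≤ c n)
    (hloc : ∀ p : ℕ, p.Prime → Summable (fun n : ℕ => if p ∣ n then c n / n else 0))
    {C₁ : ℝ} (hC₁ : Tendsto (fun M : ℕ => ∑ n ∈ Finset.range M,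
      (c n - ArithmeticFunction.vonMangoldt n) / n) atTop (𝓝 C₁))
    {L ℓ : ℕ} (hℓ : ℓ ∈ Finset.Icc 1 L) (ℓ' δ : ℕ) :
    ∃ T : ℝ, Tendsto (fun M : ℕ => ∑ n ∈ Finset.range M,
        (c n - ArithmeticFunction.vonMangoldt n) / n * (if Nat.gcd (n * ℓ') ℓ = δ then (1 : ℝ) else 0))
      atTop (𝓝 T) :=
  ⟨_, tendsto_sum_range_z_mul_of_eq_off_smallPrimes hc hloc hC₁ (L := L)
    (fun n => if Nat.gcd (n * ℓ') ℓ = δ then (1 : ℝ) else 0) (Bf := 1)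
    (fun n => by split_ifs <;> simp)
    (fun n hn => gcdClass_indicator_eq_of_forall_prime_le hn hℓ ℓ' δ)⟩

/-! ### The `M → ∞` step for finitely many pieces with their own weights -/

/-- **Regularity, finitely many pieces.**  If `∑_{n<N} a_j(n) → T_j` for every `j ∈ s`, the weight families
`w_{j,i}` are regular (eventually nonincreasing, nonnegative, vanishing from `N_j i` on; `→ 1` pointwise), and
eventually `∑_{j∈s} ∑_{n<N_j i} a_j(n) w_{j,i}(n) ≤ D' + ε` for every `ε > 0`, then `∑_{j∈s} T_j ≤ D'`. [folklore] -/
theorem typeLimit_le_of_eventually_le_sum {J : Type*} (s : Finset J) {a : J → ℕ → ℝ} {T : J → ℝ}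
    (ha : ∀ j ∈ s, Tendsto (fun M : ℕ => ∑ n ∈ Finset.range M, a j n) atTop (𝓝 (T j)))
    {ι : Type*} {l : Filter ι} [l.NeBot] (w : J → ι → ℕ → ℝ) (N : J → ι → ℕ)
    (hw_anti : ∀ j ∈ s, ∀ᶠ i in l, Antitone (w j i))
    (hw_nonneg : ∀ j ∈ s, ∀ᶠ i in l, ∀ n, 0 ≤ w j i n)
    (hw_zero : ∀ j ∈ s, ∀ᶠ i in l, ∀ n, N j i ≤ n → w j i n = 0)
    (hw_one : ∀ j ∈ s, ∀ n, Tendsto (fun i => w j i n) l (𝓝 1)) {D' : ℝ}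
    (hD : ∀ ε : ℝ, 0 < ε → ∀ᶠ i in l,
      ∑ j ∈ s, ∑ n ∈ Finset.range (N j i), a j n * w j i n ≤ D' + ε) :
    ∑ j ∈ s, T j ≤ D' := by
  have h : Tendsto (fun i => ∑ j ∈ s, ∑ n ∈ Finset.range (N j i), a j n * w j i n) l (𝓝 (∑ j ∈ s, T j)) :=
    tendsto_finsetSum s fun j hj => tendsto_sum_mul_weight_of_tendsto (ha j hj) (w j) (N j) (hw_anti j hj)
      (hw_nonneg j hj) (hw_zero j hj) (hw_one j hj)
  exact le_of_forall_pos_le_add fun ε hε => le_of_tendsto h (hD ε hε)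

/-! ### Type sums decomposed over gcd classes, and the class-weighted interface -/

/-- The weighted type sum decomposed over gcd classes:
`∑_{n∈s} f(n) Re Φ_α(n) = ∑_{ℓ,ℓ'} ∑_{δ∣ℓ} Re[α_ℓ conj(α_ℓ') δ/√(ℓℓ')] · ∑_{n∈s} f(n) 1[gcd(nℓ',ℓ) = δ]`. [folklore] -/
theorem sum_mul_re_gcdForm_eq_sum_gcdClasses (α : ℕ → ℂ) (L : ℕ) (f : ℕ → ℝ) (s : Finset ℕ) :
    ∑ n ∈ s, f n * (gcdForm α L n).re =
      ∑ ℓ ∈ Finset.Icc 1 L, ∑ ℓ' ∈ Finset.Icc 1 L, ∑ δ ∈ ℓ.divisors,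
        (α ℓ * (starRingEnd ℂ) (α ℓ') * ((δ : ℝ) : ℂ) / (Real.sqrt ((ℓ : ℝ) * ℓ') : ℂ)).re *
          ∑ n ∈ s, f n * (if Nat.gcd (n * ℓ') ℓ = δ then (1 : ℝ) else 0) := by
  simp_rw [re_gcdForm_eq_sum_gcdClasses, Finset.mul_sum]
  rw [Finset.sum_comm]
  refine Finset.sum_congr rfl fun ℓ _ => ?_
  rw [Finset.sum_comm]
  refine Finset.sum_congr rfl fun ℓ' _ => ?_
  rw [Finset.sum_comm]
  refine Finset.sum_congr rfl fun δ _ => Finset.sum_congr rfl fun n _ => ?_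
  ring

/-- **Design data from Mertens, local summability and the CLASS-WEIGHTED finite type inequalities** — the
interface in the exact shape of the comb evaluation (TI_M): for every finitely supported complex resonator the
analytic machine may use, on each gcd class `(ℓ, ℓ', δ)` (`ℓ, ℓ' ∈ [1, L]`, `δ ∣ ℓ`), its own regular cut-off family `w_{ℓℓ'δ,M}` (e.g. the
log-Riesz weights `(1 − log(κ_M n ℓℓ'/δ²)/log M)₊`) with support bound `N_{ℓℓ'δ,M}`, and deliver, for every `ε > 0`
and all large `M`,
`∑_{ℓ,ℓ'} ∑_{δ∣ℓ} Re[α_ℓ conj(α_ℓ') δ/√(ℓℓ')] ∑_{n<N} ((c−Λ)(n)/n) 1[gcd(nℓ',ℓ)=δ] w_{ℓℓ'δ,M}(n) ≤ D·Re Φ_α(1) + ε`.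
Then (with `c ≥ 0`, `c 1 = 0`, Mertens (ii) of `stub_fakeMertens`, local summability of `stub_combLocal`) the design
data AX-A ∧ AX-B ∧ AX-C(`D`) of `stub_designOfTypes` hold.  Proof: class sums converge
(`tendsto_sum_range_z_mul_of_eq_off_smallPrimes`), each weighted class sum tends to its class limit
(`tendsto_sum_mul_weight_of_tendsto`), the type limit is the same combination of class limits
(`sum_mul_re_gcdForm_eq_sum_gcdClasses`), so `T ≤ D·Re Φ_α(1)`; conclude by `designData_of_mertens_typeBound`.
[folklore] -/
theorem designData_of_mertens_local_classTypeIneq (D : ℝ) (c : ℕ → ℝ) (hc : ∀ n, 0 ≤ c n) (hc1 : c 1 = 0)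
    (hM : ∃ C : ℝ, Filter.Tendsto (fun x : ℝ => (∑ n ∈ Finset.Icc 1 ⌊x⌋₊, c n / n) - Real.log x)
      Filter.atTop (nhds C))
    (hloc : ∀ p : ℕ, p.Prime → Summable (fun n : ℕ => if p ∣ n then c n / n else 0))
    (hfin : ∀ α : ℕ → ℂ, ∀ L : ℕ, (∀ m, L < m → α m = 0) →
      ∃ (w : ℕ → ℕ → ℕ → ℕ → ℕ → ℝ) (N : ℕ → ℕ → ℕ → ℕ → ℕ),
        (∀ ℓ ∈ Finset.Icc 1 L, ∀ ℓ' ∈ Finset.Icc 1 L, ∀ δ ∈ ℓ.divisors,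
          (∀ᶠ M : ℕ in atTop, Antitone (w ℓ ℓ' δ M)) ∧
          (∀ᶠ M : ℕ in atTop, ∀ n, 0 ≤ w ℓ ℓ' δ M n) ∧
          (∀ᶠ M : ℕ in atTop, ∀ n, N ℓ ℓ' δ M ≤ n → w ℓ ℓ' δ M n = 0) ∧
          (∀ n, Tendsto (fun M : ℕ => w ℓ ℓ' δ M n) atTop (𝓝 1))) ∧
        ∀ ε : ℝ, 0 < ε → ∀ᶠ M : ℕ in atTop,
          ∑ ℓ ∈ Finset.Icc 1 L, ∑ ℓ' ∈ Finset.Icc 1 L, ∑ δ ∈ ℓ.divisors,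
            (α ℓ * (starRingEnd ℂ) (α ℓ') * ((δ : ℝ) : ℂ) / (Real.sqrt ((ℓ : ℝ) * ℓ') : ℂ)).re *
              ∑ n ∈ Finset.range (N ℓ ℓ' δ M), (c n - ArithmeticFunction.vonMangoldt n) / n *
                (if Nat.gcd (n * ℓ') ℓ = δ then (1 : ℝ) else 0) * w ℓ ℓ' δ M n
          ≤ D * (gcdForm α L 1).re + ε) :
    Summable (fun n : ℕ => |c n - ArithmeticFunction.vonMangoldt n| / (n : ℝ)) ∧
    Summable (fun n : ℕ => if 2 ≤ n ∧ ¬ IsPrimePow n then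
      c n / (n : ℝ) * (∑ q ∈ n.primeFactors, ∑ q' ∈ n.primeFactors.filter (fun q' => q < q'),
        ((Real.sqrt q - 1) / 2) * ((Real.sqrt q' - 1) / 2)) else 0) ∧
    (∀ S : Finset ℕ, (∀ p ∈ S, p.Prime) → ∀ a : ℕ → ℝ, (∀ p ∈ S, 0 ≤ a p ∧ a p ≤ 1) → ∀ φ : ℝ,
      (∑' n : ℕ, (c n - ArithmeticFunction.vonMangoldt n) / (n : ℝ) *
        (if ∀ p ∈ S, ¬ (p ^ 2 ∣ n) then
          Real.sqrt (∏ p ∈ S.filter (· ∣ n), (p : ℝ)) * (∏ p ∈ S.filter (· ∣ n), a p) *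
            (1 / 2) ^ (S.filter (· ∣ n)).card * Real.cos (((S.filter (· ∣ n)).card : ℝ) * φ)
        else 0)) ≤ D) := by
  obtain ⟨C, hC⟩ := hM
  have hC₁ : Tendsto (fun M : ℕ => ∑ n ∈ Finset.range M,
      (c n - ArithmeticFunction.vonMangoldt n) / n) atTop (𝓝 (C + Real.eulerMascheroniConstant)) :=
    tendsto_sum_range_of_tendsto_sum_Icc_floor
      (f := fun n => (c n - ArithmeticFunction.vonMangoldt n) / n) (by simp)
      (tendsto_sum_sub_vonMangoldt_div_of_mertens hC)
  refine designData_of_mertens_typeBound D c hc hc1 ⟨C, hC⟩ hloc fun α L hα T hT => ?_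
  obtain ⟨w, N, hreg, hε⟩ := hfin α L hα
  -- notation: coefficients, class indicators, class limits
  set κ : ℕ → ℕ → ℕ → ℝ := fun ℓ ℓ' δ =>
    (α ℓ * (starRingEnd ℂ) (α ℓ') * ((δ : ℝ) : ℂ) / (Real.sqrt ((ℓ : ℝ) * ℓ') : ℂ)).re with hκ
  set ind : ℕ → ℕ → ℕ → ℕ → ℝ := fun ℓ ℓ' δ n => if Nat.gcd (n * ℓ') ℓ = δ then (1 : ℝ) else 0 with hind
  set Tc : ℕ → ℕ → ℕ → ℝ := fun ℓ ℓ' δ => ind ℓ ℓ' δ 1 * (C + Real.eulerMascheroniConstant) +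
    ∑' n : ℕ, (c n - ArithmeticFunction.vonMangoldt n) / n * (ind ℓ ℓ' δ n - ind ℓ ℓ' δ 1) with hTc
  -- the class sums converge to `Tc`
  have hclass : ∀ ℓ ∈ Finset.Icc 1 L, ∀ ℓ' δ : ℕ, Tendsto (fun M : ℕ => ∑ n ∈ Finset.range M,
      (c n - ArithmeticFunction.vonMangoldt n) / n * ind ℓ ℓ' δ n) atTop (𝓝 (Tc ℓ ℓ' δ)) :=
    fun ℓ hℓ ℓ' δ => tendsto_sum_range_z_mul_of_eq_off_smallPrimes hc hloc hC₁ (L := L) (ind ℓ ℓ' δ)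
      (Bf := 1) (fun n => by simp only [hind]; split_ifs <;> simp)
      (fun n hn => gcdClass_indicator_eq_of_forall_prime_le hn hℓ ℓ' δ)
  -- the type partial sums, `ℕ`-indexed, tend to `T` and to the combination of class limits
  have hT' : Tendsto (fun M : ℕ => ∑ n ∈ Finset.range M,
      (c n - ArithmeticFunction.vonMangoldt n) / n * (gcdForm α L n).re) atTop (𝓝 T) :=
    tendsto_sum_range_of_tendsto_sum_Icc_floor
      (f := fun n => (c n - ArithmeticFunction.vonMangoldt n) / n * (gcdForm α L n).re) (by simp) hT
  have hT'' : Tendsto (fun M : ℕ => ∑ n ∈ Finset.range M,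
      (c n - ArithmeticFunction.vonMangoldt n) / n * (gcdForm α L n).re) atTop
      (𝓝 (∑ ℓ ∈ Finset.Icc 1 L, ∑ ℓ' ∈ Finset.Icc 1 L, ∑ δ ∈ ℓ.divisors, κ ℓ ℓ' δ * Tc ℓ ℓ' δ)) := by
    have h : Tendsto (fun M : ℕ => ∑ ℓ ∈ Finset.Icc 1 L, ∑ ℓ' ∈ Finset.Icc 1 L, ∑ δ ∈ ℓ.divisors,
        κ ℓ ℓ' δ * ∑ n ∈ Finset.range M, (c n - ArithmeticFunction.vonMangoldt n) / n * ind ℓ ℓ' δ n)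
        atTop (𝓝 (∑ ℓ ∈ Finset.Icc 1 L, ∑ ℓ' ∈ Finset.Icc 1 L, ∑ δ ∈ ℓ.divisors, κ ℓ ℓ' δ * Tc ℓ ℓ' δ)) :=
      tendsto_finsetSum _ fun ℓ hℓ => tendsto_finsetSum _ fun ℓ' _ => tendsto_finsetSum _ fun δ _ =>
        (hclass ℓ hℓ ℓ' δ).const_mul _
    refine h.congr fun M => ?_
    rw [sum_mul_re_gcdForm_eq_sum_gcdClasses]
  have hTeq : T = ∑ ℓ ∈ Finset.Icc 1 L, ∑ ℓ' ∈ Finset.Icc 1 L, ∑ δ ∈ ℓ.divisors, κ ℓ ℓ' δ * Tc ℓ ℓ' δ :=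
    tendsto_nhds_unique hT' hT''
  -- the class-weighted sums tend to the same combination
  have hW : Tendsto (fun M : ℕ => ∑ ℓ ∈ Finset.Icc 1 L, ∑ ℓ' ∈ Finset.Icc 1 L, ∑ δ ∈ ℓ.divisors,
      κ ℓ ℓ' δ * ∑ n ∈ Finset.range (N ℓ ℓ' δ M), (c n - ArithmeticFunction.vonMangoldt n) / n *
        ind ℓ ℓ' δ n * w ℓ ℓ' δ M n)
      atTop (𝓝 (∑ ℓ ∈ Finset.Icc 1 L, ∑ ℓ' ∈ Finset.Icc 1 L, ∑ δ ∈ ℓ.divisors, κ ℓ ℓ' δ * Tc ℓ ℓ' δ)) := by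
    refine tendsto_finsetSum _ fun ℓ hℓ => tendsto_finsetSum _ fun ℓ' hℓ' => tendsto_finsetSum _ fun δ hδ => ?_
    obtain ⟨h1, h2, h3, h4⟩ := hreg ℓ hℓ ℓ' hℓ' δ hδ
    exact (tendsto_sum_mul_weight_of_tendsto
      (a := fun n => (c n - ArithmeticFunction.vonMangoldt n) / n * ind ℓ ℓ' δ n)
      (hclass ℓ hℓ ℓ' δ) (w ℓ ℓ' δ) (N ℓ ℓ' δ) h1 h2 h3 h4).const_mul _
  rw [hTeq]
  exact le_of_forall_pos_le_add fun ε hε' => le_of_tendsto hW (hε ε hε')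

end TypeDesign

end Literature.NumberTheory.LFunctions
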